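import Mathlib
import HarnessLib
import Summits.HubbardSuperconductivity.HubbardSuperconductivity.Theorems.KLProgrammeCooperChannelRiccatiFlowEnvelope

/-!
# Route `KLProgramme` — DECOMP C2 «ChannelRiccati» in Lean, VII: the attractive UPPER envelope
# (the `a₋` side of C2 (b): `λ_h ≤ -a₋U² / (1 - a₋U² Σ b) + summable junk`)

Cell gate-hubbard-kl, seat p3; scalar continuation of file III (`…FlowEnvelope.lean`, same namespace).  File III's
`attractive_lower_envelope` is the `a₊` side of DECOMP C2 (b) (`λ_h ≥ -a₊U²/(1 - a₊U² B_h)`: the block cannot run away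
faster than the envelope of its total drive); files V (`…FlowDiagonal.lean`: `formInf V_k ≤ Re ⟪ψ, V_k ψ⟫`, the diagonal
is a cascade SUBsolution with weights `b_k(1-ε)/(1+b_k‖V_k‖)`) reduce the `a₋` side — the leading block DOES run away at
least as fast as the envelope of the drive it has verifiably received — to the scalar statement proved here:

* `cascadeStep_add_le_of_concave` — on the branch `1 + βx > 0` the cascade map is concave:
  `cascadeStep β (a + D) ≤ cascadeStep β a + D / (1 + β a)²` for `D ≥ 0`;
* **`attractive_upper_envelope`** — if `t₀ ≤ -A` (`A ≥ 0`: the drive already injected), `β_k ≥ 0`, `e_k ≥ 0`,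
  `A · B_N < 1` (`B_k = Σ_{j<k} β_j`), the sequence stays on the branch (`1 + β_k t_k > 0`, which the block budget
  `b_k ‖V_k‖ ≤ 1/4` of file IV supplies) and `t_{k+1} ≤ cascadeStep β_k t_k + e_k`, then for all `k ≤ N`
  `t_k ≤ attractiveEnvelope A B_k + E_k / (1 - A B_k)²` (`E_k = Σ_{j<k} e_j`): the subsolution is below the exact envelope
  of its initial drive up to the accumulated positive junk, amplified by at most `(1 - A B_k)⁻² ≤ η⁻²` on the `(1-η)`-range.

With `A = a_{B1g}⁻ U²` (C3-NOTE §4.2) this is the upper half of `λ_h(B1g) ∈ -a_± U²/(1 - a_± U² Σ_{k>h} b_k)`.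

References: HOME/DECOMP.md v7 §2 C2 (b); HOME/p3/C3-NOTE.md §4.2–4.3.
-/

noncomputable section

namespace Summit.HubbardSuperconductivity.HubbardSuperconductivity.Theorems.CooperChannelRiccatiFlow

set_option linter.dupNamespace false -- summit = problem name (single-conjunct summit), D-0017

open Finset

/-- **Concavity of the cascade map on its branch:** for `1 + β a > 0`, `β ≥ 0`, `D ≥ 0`:
`cascadeStep β (a + D) ≤ cascadeStep β a + D / (1 + β a)²` (the tangent line at `a` lies above the graph). -/
theorem cascadeStep_add_le_of_concave {β a D : ℝ} (hβ : 0 ≤ β) (ha : 0 < 1 + β * a) (hD : 0 ≤ D) :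
    cascadeStep β (a + D) ≤ cascadeStep β a + D / (1 + β * a) ^ 2 := by
  have haD : 0 < 1 + β * (a + D) := by nlinarith [mul_nonneg hβ hD]
  have key : cascadeStep β (a + D) - cascadeStep β a = D / ((1 + β * a) * (1 + β * (a + D))) := by
    rw [cascadeStep, cascadeStep, div_sub_div _ _ haD.ne' ha.ne']
    rw [div_eq_div_iff (mul_ne_zero haD.ne' ha.ne') (mul_ne_zero ha.ne' haD.ne')]
    ring
  have hle : D / ((1 + β * a) * (1 + β * (a + D))) ≤ D / (1 + β * a) ^ 2 := by
    apply div_le_div_of_nonneg_left hD (by positivity)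
    rw [sq]
    exact mul_le_mul_of_nonneg_left (by nlinarith [mul_nonneg hβ hD]) ha.le
  linarith

/-- **Attractive upper envelope (DECOMP C2 (b), the `a₋` side).**  Let `β_k, e_k ≥ 0`, `A ≥ 0`, `t₀ ≤ -A`, no onset up
to `N` (`A · Σ_{j<N} β_j < 1`), the sequence on the branch (`1 + β_k t_k > 0` for `k < N`) and a cascade SUBsolution up to
`e_k`: `t_{k+1} ≤ cascadeStep β_k t_k + e_k`.  Then for all `k ≤ N`, with `B_k = Σ_{j<k} β_j`, `E_k = Σ_{j<k} e_j`:
`t_k ≤ attractiveEnvelope A B_k + E_k / (1 - A B_k)²`. -/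
theorem attractive_upper_envelope {β e t : ℕ → ℝ} {A : ℝ} {N : ℕ} (hβ : ∀ k, 0 ≤ β k) (he : ∀ k, 0 ≤ e k)
    (hA : 0 ≤ A) (ht0 : t 0 ≤ -A) (honset : A * (∑ j ∈ range N, β j) < 1)
    (hbranch : ∀ k < N, 0 < 1 + β k * t k) (hstep : ∀ k < N, t (k + 1) ≤ cascadeStep (β k) (t k) + e k) :
    ∀ k ≤ N, t k ≤ attractiveEnvelope A (∑ j ∈ range k, β j) +
      (∑ j ∈ range k, e j) / (1 - A * ∑ j ∈ range k, β j) ^ 2 := by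
  set B : ℕ → ℝ := fun k => ∑ j ∈ range k, β j with hB_def
  set Es : ℕ → ℝ := fun k => ∑ j ∈ range k, e j with hE_def
  have hB_nonneg : ∀ k, 0 ≤ B k := fun k => sum_nonneg fun j _ => hβ j
  have hE_nonneg : ∀ k, 0 ≤ Es k := fun k => sum_nonneg fun j _ => he j
  have hB_mono : ∀ {k l}, k ≤ l → B k ≤ B l := fun {k l} hkl =>
    sum_le_sum_of_subset_of_nonneg (range_mono hkl) fun j _ _ => hβ j
  have hB_succ : ∀ k, B (k + 1) = B k + β k := fun k => by simp only [hB_def, sum_range_succ]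
  have hE_succ : ∀ k, Es (k + 1) = Es k + e k := fun k => by simp only [hE_def, sum_range_succ]
  have hAB : ∀ {k}, k ≤ N → A * B k < 1 := fun {k} hk =>
    lt_of_le_of_lt (mul_le_mul_of_nonneg_left (hB_mono hk) hA) honset
  intro k
  induction k with
  | zero =>
    intro _
    have h0 : attractiveEnvelope A (B 0) + Es 0 / (1 - A * B 0) ^ 2 = -A := by
      simp [hB_def, hE_def, attractiveEnvelope]
    show t 0 ≤ attractiveEnvelope A (B 0) + Es 0 / (1 - A * B 0) ^ 2
    rw [h0]
    exact ht0
  | succ k ih =>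
    intro hk
    have hk' : k < N := Nat.lt_of_succ_le hk
    have ihk : t k ≤ attractiveEnvelope A (B k) + Es k / (1 - A * B k) ^ 2 := ih hk'.le
    have h1 : 0 < 1 - A * B k := by linarith [hAB hk'.le]
    have h2 : 0 < 1 - A * B (k + 1) := by linarith [hAB hk]
    have h2' : 0 < 1 - A * (B k + β k) := by rw [← hB_succ]; exact h2
    -- the envelope point a_k and its branch value
    set a : ℝ := attractiveEnvelope A (B k) with ha_def
    have hβa : 1 + β k * a = (1 - A * (B k + β k)) / (1 - A * B k) := one_add_mul_attractiveEnvelope h1.ne'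
    have hapos : 0 < 1 + β k * a := by rw [hβa]; exact div_pos h2' h1
    have hD : 0 ≤ Es k / (1 - A * B k) ^ 2 := div_nonneg (hE_nonneg k) (sq_nonneg _)
    have haDpos : 0 < 1 + β k * (a + Es k / (1 - A * B k) ^ 2) := by nlinarith [mul_nonneg (hβ k) hD]
    -- monotone step, then concavity, then the envelope algebra
    have hmono : cascadeStep (β k) (t k) ≤ cascadeStep (β k) (a + Es k / (1 - A * B k) ^ 2) :=
      cascadeStep_mono ihk (hbranch k hk') haDpos
    have hconc := cascadeStep_add_le_of_concave (hβ k) hapos hD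
    have henv : cascadeStep (β k) a = attractiveEnvelope A (B (k + 1)) := by
      rw [ha_def, cascadeStep_attractiveEnvelope h1.ne' h2'.ne', hB_succ]
    -- the amplification factor of the junk: `(1 + β a)⁻² = ((1 - A B_k)/(1 - A B_{k+1}))²`
    have hfac : Es k / (1 - A * B k) ^ 2 / (1 + β k * a) ^ 2 = Es k / (1 - A * B (k + 1)) ^ 2 := by
      rw [hβa, hB_succ]
      field_simp
    have hjunk : Es k / (1 - A * B (k + 1)) ^ 2 + e k ≤ Es (k + 1) / (1 - A * B (k + 1)) ^ 2 := by
      rw [hE_succ, add_div]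
      gcongr _ + ?_
      rw [le_div_iff₀ (by positivity)]
      have hsq : (1 - A * B (k + 1)) ^ 2 ≤ 1 := by
        have hABn : 0 ≤ A * B (k + 1) := mul_nonneg hA (hB_nonneg _)
        nlinarith
      nlinarith [he k]
    show t (k + 1) ≤ attractiveEnvelope A (B (k + 1)) + Es (k + 1) / (1 - A * B (k + 1)) ^ 2
    calc t (k + 1) ≤ cascadeStep (β k) (t k) + e k := hstep k hk'
      _ ≤ cascadeStep (β k) (a + Es k / (1 - A * B k) ^ 2) + e k := by linarith
      _ ≤ cascadeStep (β k) a + Es k / (1 - A * B k) ^ 2 / (1 + β k * a) ^ 2 + e k := by linarith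
      _ = attractiveEnvelope A (B (k + 1)) + (Es k / (1 - A * B (k + 1)) ^ 2 + e k) := by rw [henv, hfac]; ring
      _ ≤ attractiveEnvelope A (B (k + 1)) + Es (k + 1) / (1 - A * B (k + 1)) ^ 2 := by linarith

/-- On the `(1 - η)`-range the junk is amplified by at most `η⁻²`: if `A B_k ≤ 1 - η` with `0 < η` then
`E_k / (1 - A B_k)² ≤ E_k / η²`. -/
theorem junk_le_of_range {A Bk Ek η : ℝ} (hη : 0 < η) (hEk : 0 ≤ Ek) (hrange : A * Bk ≤ 1 - η) :
    Ek / (1 - A * Bk) ^ 2 ≤ Ek / η ^ 2 := by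
  apply div_le_div_of_nonneg_left hEk (by positivity)
  gcongr
  linarith

/-! ## The gap assembled (DECOMP C2 (c) with certified inputs)

Leader (`B1g`): `t_k ≤ attractiveEnvelope A_B B_k + E_k/(1 - A_B B_k)²` (`attractive_upper_envelope`, `A_B = a_B⁻ U²`).
Competitor `Γ`: `x_k ≥ attractiveEnvelope A_Γ B_k` (file III `attractive_lower_envelope` with all its drive booked at once,
`A_Γ = a_Γ⁺ U²`).  Since `a ↦ -attractiveEnvelope a B = a/(1 - aB)` has slope `≥ 1` before the onset, the initial gap
`A_B - A_Γ` (the certificate's `γ U²` minus the C3 junk) is never diminished by the flow: -/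

/-- **The attractive envelope has slope at least one in the drive:** for `0 ≤ A' ≤ A`, `0 ≤ B`, `A B < 1`:
`attractiveEnvelope A B ≤ attractiveEnvelope A' B - (A - A')` (equivalently `A/(1-AB) - A'/(1-A'B) ≥ A - A'`). -/
theorem attractiveEnvelope_sub_ge {A A' B : ℝ} (hA' : 0 ≤ A') (hAA' : A' ≤ A) (hB : 0 ≤ B) (hAB : A * B < 1) :
    attractiveEnvelope A B ≤ attractiveEnvelope A' B - (A - A') := by
  have h := attractiveEnvelope_add_le hA' (sub_nonneg.mpr hAA') hB (by rwa [add_sub_cancel])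
  rwa [add_sub_cancel] at h

/-- **The certified gap propagates (DECOMP C2 (c)).**  If the leader's form bottom obeys the attractive UPPER envelope with
drive `A_B` and junk `J` (`t ≤ attractiveEnvelope A_B B + J`) and a competitor's bottom obeys the attractive LOWER envelope with
total drive `A_Γ ≤ A_B` (`attractiveEnvelope A_Γ B ≤ x`), then before the leader's onset (`A_B B < 1`)
`x - t ≥ (A_B - A_Γ) - J`: the initial gap is never diminished by the flow, only the junk is subtracted.  With
`A_B - A_Γ = (a_B⁻ - a_Γ⁺) U² ≥ (γ_cert - C3 junk) U²` and `J ≤ E_N/η²` on the `(1-η)`-range (`junk_le_of_range`). -/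
theorem gap_propagates {A_B A_Γ B J t x : ℝ} (hAΓ : 0 ≤ A_Γ) (hle : A_Γ ≤ A_B) (hB : 0 ≤ B) (honset : A_B * B < 1)
    (ht : t ≤ attractiveEnvelope A_B B + J) (hx : attractiveEnvelope A_Γ B ≤ x) :
    (A_B - A_Γ) - J ≤ x - t := by
  have h := attractiveEnvelope_sub_ge hAΓ hle hB honset
  linarith

/-- **Reduced masses are a reduced drive:** `attractiveEnvelope A (c B) ≤ attractiveEnvelope (c A) B` for `c ≤ 1`, `A ≥ 0`
before the onset (both sides have the denominator `1 - c A B`).  Use: the leader's upper envelope runs with the reduced masses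
`β_k = c b_k` (`c = (1-ε)/(1+bM)`, file V), the competitors' lower envelopes with `b_k`; this lemma puts both on the common mass
`B_k = Σ b` at the price `A_B ↦ c A_B`, after which `gap_propagates` applies with the condition `A_Γ ≤ c A_B`. -/
theorem attractiveEnvelope_scale_le {A B c : ℝ} (hA : 0 ≤ A) (hc1 : c ≤ 1) (h : c * A * B < 1) :
    attractiveEnvelope A (c * B) ≤ attractiveEnvelope (c * A) B := by
  have hden : 0 < 1 - c * A * B := by linarith
  rw [attractiveEnvelope, attractiveEnvelope, show A * (c * B) = c * A * B by ring,
    div_le_div_iff_of_pos_right hden]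
  nlinarith

end Summit.HubbardSuperconductivity.HubbardSuperconductivity.Theorems.CooperChannelRiccatiFlow

end
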